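import Literature.InformationTheory.QuantumCodes.SubsystemCodes
import Literature.InformationTheory.QuantumCodes.LocalCodeDistanceBound
import HarnessLib

/-!
# The 2 × 2 Bacon–Shor code: a genuine subsystem code (non-vacuity of `IsSubsystemCode`)

S. Bravyi, B. Terhal, arXiv:0810.1983 [BravyiTerhal2009], §1.3 (chunk p0007 L64–86): «the gauge group `𝒢` of the
2D Bacon-Shor code has generators `X_{i,j}X_{i+1,j}` and `Z_{i,j}Z_{i,j+1}`. This code has distance `L`. The
stabilizer group `𝒮` is generated by `S^x_i = ∏_j X_{i,j}X_{i+1,j}` and `S^z_j = ∏_i Z_{i,j}Z_{i,j+1}` … The code has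
one logical qubit with logical Pauli operators `X̄ = ∏_j X_{1,j}` and `Z̄ = ∏_i Z_{i,1}`»; S. Bravyi,
arXiv:1008.1029 [Bravyi2011Subsystem], §3 (the generalized Bacon–Shor codes; the all-ones `A` is the standard code).

THIS FILE gives the smallest instance `L = 2` (qubits `0 = (1,1), 1 = (1,2), 2 = (2,1), 3 = (2,2)`), with every
claim PROVED: the gauge space `Ḡ = ⟨X₀X₂, X₁X₃, Z₀Z₁, Z₂Z₃⟩` (`BaconShor.gauge`), explicit membership tests for `Ḡ`,
`Ḡ⊥` and the stabilizer space `S̄ = Ḡ ⊓ Ḡ⊥ = {0, XXXX, ZZZZ, YYYY}`, `dim Ḡ = 4`, `dim S̄ = 2`, and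
`BaconShor.isSubsystemCode : IsSubsystemCode gauge 1 2` — one logical qubit, (one gauge qubit,) distance `2 = L`,
attained by `X̄ = X₀X₁` (`not_hasSubsystemMinDist_three`); `Ḡ` is not self-orthogonal (`not_isSelfOrthogonal`),
so this is a subsystem code that is not a stabilizer code — the vocabulary of `SubsystemCodes.lean` is inhabited
beyond the embedded stabilizer codes.

## Mathlib / tree search

Tree: `gaugeStabilizer`, `IsSubsystemCode`, `HasSubsystemMinDist`, `finrank_sympDual_add`, `sympInner`,
`sympWeight`, `mem_sympDual_iff`, `mem_sympDual_span_of_forall` (SymplecticCodes / SubsystemCodes /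
CorrectableRegions); Mathlib `finrank_span_eq_card`, `Fintype.linearIndependent_iff`, `Fin.sum_univ_four`.
No Bacon–Shor instance in the tree before (`lean search BaconShor` → nothing).
-/

namespace Literature.InformationTheory.QuantumCodes

open Finset Module
open Classical

namespace BaconShor

/-- An X-type Pauli class on 4 qubits with the given X-part. [cite: BravyiTerhal2009, §1.1 (symplectic representation)] -/
def xOp (f : Fin 4 → ZMod 2) : SympVec 4 := (f, 0)

/-- A Z-type Pauli class on 4 qubits with the given Z-part. [cite: BravyiTerhal2009, §1.1 (symplectic representation)] -/
def zOp (f : Fin 4 → ZMod 2) : SympVec 4 := (0, f)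

/-- The four gauge generators of the `2 × 2` Bacon–Shor code: `X₀X₂, X₁X₃` (vertical `XX`) and `Z₀Z₁, Z₂Z₃`
(horizontal `ZZ`). Column: definition. [cite: BravyiTerhal2009, §1.3 (p. 7: «generators X_{i,j}X_{i+1,j} and Z_{i,j}Z_{i,j+1}»)] -/
def gen : Fin 4 → SympVec 4 :=
  ![xOp ![1, 0, 1, 0], xOp ![0, 1, 0, 1], zOp ![1, 1, 0, 0], zOp ![0, 0, 1, 1]]

/-- The gauge space `Ḡ` of the `2 × 2` Bacon–Shor code. Column: definition.
[cite: BravyiTerhal2009, §1.3 (p. 7); Bravyi2011Subsystem, §3 (all-ones matrix A)] -/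
def gauge : Submodule (ZMod 2) (SympVec 4) := Submodule.span (ZMod 2) (Set.range gen)

/-- The two stabilizer generators `XXXX = S^x_1` and `ZZZZ = S^z_1`. Column: definition.
[cite: BravyiTerhal2009, §1.3 (p. 7: «S^x_i = ∏_j X_{i,j}X_{i+1,j} and S^z_j = ∏_i Z_{i,j}Z_{i,j+1}»)] -/
def stabGen : Fin 2 → SympVec 4 := ![xOp fun _ => 1, zOp fun _ => 1]

/-- The logical `X̄ = X_{1,1}X_{1,2} = X₀X₁`. Column: definition. [cite: BravyiTerhal2009, §1.3 (p. 7: «X̄ = ∏_j X_{1,j}»)] -/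
def logicalX : SympVec 4 := xOp ![1, 1, 0, 0]

/-! ### Membership tests -/

/-- `Ḡ` explicitly: X-parts equal along columns, Z-parts equal along rows. [cite: BravyiTerhal2009, §1.3 (p. 7)] -/
theorem mem_gauge_iff {v : SympVec 4} :
    v ∈ gauge ↔ v.1 0 = v.1 2 ∧ v.1 1 = v.1 3 ∧ v.2 0 = v.2 1 ∧ v.2 2 = v.2 3 := by
  constructor
  · intro hv
    induction hv using Submodule.span_induction with
    | mem x hx =>
      obtain ⟨i, rfl⟩ := hx
      fin_cases i <;> simp [gen, xOp, zOp]
    | zero => simp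
    | add x y _ _ hx hy =>
      simp only [Prod.fst_add, Prod.snd_add, Pi.add_apply]
      rw [hx.1, hx.2.1, hx.2.2.1, hx.2.2.2, hy.1, hy.2.1, hy.2.2.1, hy.2.2.2]
      exact ⟨rfl, rfl, rfl, rfl⟩
    | smul a x _ hx =>
      simp only [Prod.smul_fst, Prod.smul_snd, Pi.smul_apply, smul_eq_mul]
      rw [hx.1, hx.2.1, hx.2.2.1, hx.2.2.2]
      exact ⟨rfl, rfl, rfl, rfl⟩
  · rintro ⟨h1, h2, h3, h4⟩
    have hv : v = v.1 0 • gen 0 + v.1 1 • gen 1 + v.2 0 • gen 2 + v.2 2 • gen 3 := by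
      ext i <;> fin_cases i <;> simp [gen, xOp, zOp, h1, h2, h3, h4]
    rw [hv]
    refine Submodule.add_mem _ (Submodule.add_mem _ (Submodule.add_mem _ ?_ ?_) ?_) ?_ <;>
      exact Submodule.smul_mem _ _ (Submodule.subset_span ⟨_, rfl⟩)

/-- Symplectic products with the gauge generators. [cite: BravyiTerhal2009, §1.1 (symplectic representation)] -/
theorem sympInner_gen (v : SympVec 4) :
    sympInner (gen 0) v = v.2 0 + v.2 2 ∧ sympInner (gen 1) v = v.2 1 + v.2 3 ∧
      sympInner (gen 2) v = v.1 0 + v.1 1 ∧ sympInner (gen 3) v = v.1 2 + v.1 3 := by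
  simp [sympInner, dotProduct, Fin.sum_univ_four, gen, xOp, zOp]

/-- `Ḡ⊥` explicitly (bare logical operators and stabilizers). [cite: BravyiTerhal2009, §1.3 (p. 7)] -/
theorem mem_sympDual_gauge_iff {v : SympVec 4} :
    v ∈ sympDual gauge ↔ v.2 0 + v.2 2 = 0 ∧ v.2 1 + v.2 3 = 0 ∧ v.1 0 + v.1 1 = 0 ∧ v.1 2 + v.1 3 = 0 := by
  have h := sympInner_gen v
  constructor
  · intro hv
    rw [mem_sympDual_iff] at hv
    have hg : ∀ i, sympInner (gen i) v = 0 := fun i => hv _ (Submodule.subset_span ⟨i, rfl⟩)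
    exact ⟨h.1 ▸ hg 0, h.2.1 ▸ hg 1, h.2.2.1 ▸ hg 2, h.2.2.2 ▸ hg 3⟩
  · rintro ⟨h1, h2, h3, h4⟩
    unfold gauge
    refine mem_sympDual_span_of_forall _ fun i => ?_
    fin_cases i
    · exact h.1.trans h1
    · exact h.2.1.trans h2
    · exact h.2.2.1.trans h3
    · exact h.2.2.2.trans h4

/-- In `ZMod 2`, `a + b = 0 ↔ a = b`. [folklore] -/
private theorem add_eq_zero_iff' (a b : ZMod 2) : a + b = 0 ↔ a = b := by
  revert a b; decide

/-- The stabilizer space `S̄ = Ḡ ⊓ Ḡ⊥` explicitly: all X-parts equal and all Z-parts equal, i.e.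
`{I, XXXX, ZZZZ, YYYY}`. [cite: BravyiTerhal2009, §1.3 (p. 7: «𝒮 is generated by S^x_i … and S^z_j …»)] -/
theorem mem_gaugeStabilizer_iff {v : SympVec 4} :
    v ∈ gaugeStabilizer gauge ↔
      (v.1 0 = v.1 1 ∧ v.1 0 = v.1 2 ∧ v.1 0 = v.1 3) ∧ (v.2 0 = v.2 1 ∧ v.2 0 = v.2 2 ∧ v.2 0 = v.2 3) := by
  unfold gaugeStabilizer
  rw [Submodule.mem_inf, mem_gauge_iff, mem_sympDual_gauge_iff, add_eq_zero_iff', add_eq_zero_iff',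
    add_eq_zero_iff', add_eq_zero_iff']
  constructor
  · rintro ⟨⟨a1, a2, a3, a4⟩, ⟨b1, b2, b3, b4⟩⟩
    exact ⟨⟨b3, a1, b3.trans a2⟩, ⟨a3, b1, b1.trans a4⟩⟩
  · rintro ⟨⟨c1, c2, c3⟩, ⟨e1, e2, e3⟩⟩
    exact ⟨⟨c2, c1.symm.trans c3, e1, e2.symm.trans e3⟩, ⟨e2, e1.symm.trans e3, c1, c2.symm.trans c3⟩⟩

/-- The stabilizer space is spanned by `XXXX` and `ZZZZ`. [cite: BravyiTerhal2009, §1.3 (p. 7)] -/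
theorem gaugeStabilizer_eq_span : gaugeStabilizer gauge = Submodule.span (ZMod 2) (Set.range stabGen) := by
  apply le_antisymm
  · intro v hv
    rw [mem_gaugeStabilizer_iff] at hv
    obtain ⟨⟨c1, c2, c3⟩, ⟨e1, e2, e3⟩⟩ := hv
    have hv' : v = v.1 0 • stabGen 0 + v.2 0 • stabGen 1 := by
      ext i <;> fin_cases i <;> simp [stabGen, xOp, zOp, ← c1, ← c2, ← c3, ← e1, ← e2, ← e3]
    rw [hv']
    exact Submodule.add_mem _ (Submodule.smul_mem _ _ (Submodule.subset_span ⟨0, rfl⟩))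
      (Submodule.smul_mem _ _ (Submodule.subset_span ⟨1, rfl⟩))
  · rw [Submodule.span_le]
    rintro _ ⟨i, rfl⟩
    rw [SetLike.mem_coe, mem_gaugeStabilizer_iff]
    fin_cases i <;> simp [stabGen, xOp, zOp]

/-! ### Dimensions -/

/-- The four gauge generators are independent: `dim Ḡ = 4`. [cite: BravyiTerhal2009, §1.3 (p. 7)] -/
theorem finrank_gauge : finrank (ZMod 2) gauge = 4 := by
  have hli : LinearIndependent (ZMod 2) gen := by
    rw [Fintype.linearIndependent_iff]
    intro g hg i
    have h0 := congrArg (fun w : SympVec 4 => w.1 0) hg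
    have h1 := congrArg (fun w : SympVec 4 => w.1 1) hg
    have h2 := congrArg (fun w : SympVec 4 => w.2 0) hg
    have h3 := congrArg (fun w : SympVec 4 => w.2 2) hg
    simp [Fin.sum_univ_four, gen, xOp, zOp] at h0 h1 h2 h3
    fin_cases i <;> assumption
  unfold gauge
  rw [finrank_span_eq_card hli, Fintype.card_fin]

/-- `dim S̄ = 2`. [cite: BravyiTerhal2009, §1.3 (p. 7)] -/
theorem finrank_gaugeStabilizer : finrank (ZMod 2) (gaugeStabilizer gauge) = 2 := by
  have hli : LinearIndependent (ZMod 2) stabGen := by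
    rw [Fintype.linearIndependent_iff]
    intro g hg i
    have h0 := congrArg (fun w : SympVec 4 => w.1 0) hg
    have h2 := congrArg (fun w : SympVec 4 => w.2 0) hg
    simp [Fin.sum_univ_two, stabGen, xOp, zOp] at h0 h2
    fin_cases i <;> assumption
  rw [gaugeStabilizer_eq_span, finrank_span_eq_card hli, Fintype.card_fin]

/-- `dim Ḡ⊥ = 4`. [cite: BravyiTerhal2009, §1.3 (p. 7)] -/
theorem finrank_sympDual_gauge : finrank (ZMod 2) (sympDual gauge) = 4 := by
  have h := finrank_sympDual_add gauge
  rw [finrank_gauge] at h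
  omega

/-! ### The code parameters -/

/-- A dressed logical operator has weight `≥ 2`: a single-qubit Pauli anticommutes with `XXXX` or `ZZZZ`.
[cite: BravyiTerhal2009, §1.3 (p. 7: «This code has distance L»), L = 2] -/
theorem hasSubsystemMinDist_two : HasSubsystemMinDist gauge 2 := by
  intro v hv hvG
  -- v commutes with XXXX and ZZZZ: its Z-part and its X-part have even parity
  rw [mem_sympDual_iff] at hv
  have hX : sympInner (stabGen 0) v = 0 :=
    hv _ (by rw [gaugeStabilizer_eq_span]; exact Submodule.subset_span ⟨0, rfl⟩)
  have hZ : sympInner (stabGen 1) v = 0 :=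
    hv _ (by rw [gaugeStabilizer_eq_span]; exact Submodule.subset_span ⟨1, rfl⟩)
  have hX' : ∑ i, v.2 i = 0 := by
    simpa [sympInner, dotProduct, stabGen, xOp, zOp] using hX
  have hZ' : ∑ i, v.1 i = 0 := by
    simpa [sympInner, dotProduct, stabGen, xOp, zOp] using hZ
  by_contra hlt
  rw [not_le] at hlt
  -- weight ≤ 1: all support points coincide
  have hw : ∀ a b : Fin 4, (v.1 a ≠ 0 ∨ v.2 a ≠ 0) → (v.1 b ≠ 0 ∨ v.2 b ≠ 0) → a = b := by
    intro a b ha hb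
    unfold sympWeight at hlt
    exact Finset.card_le_one.1 (Nat.lt_succ_iff.1 hlt) a (by simpa using ha) b (by simpa using hb)
  -- hence v = 0 ∈ Ḡ, contradiction
  apply hvG
  have key : ∀ a : Fin 4, v.1 a = 0 ∧ v.2 a = 0 := by
    by_contra hne
    push Not at hne
    obtain ⟨a, ha⟩ := hne
    have ha' : v.1 a ≠ 0 ∨ v.2 a ≠ 0 := by
      by_cases h : v.1 a = 0
      · exact Or.inr (ha h)
      · exact Or.inl h
    have hoth : ∀ b : Fin 4, b ≠ a → v.1 b = 0 ∧ v.2 b = 0 := by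
      intro b hb
      by_contra hb'
      have : v.1 b ≠ 0 ∨ v.2 b ≠ 0 := by
        by_cases h : v.1 b = 0
        · exact Or.inr fun h' => hb' ⟨h, h'⟩
        · exact Or.inl h
      exact hb (hw b a this ha')
    rw [Finset.sum_eq_single a (fun b _ hb => (hoth b hb).2) (by simp)] at hX'
    rw [Finset.sum_eq_single a (fun b _ hb => (hoth b hb).1) (by simp)] at hZ'
    rcases ha' with h | h
    · exact h hZ'
    · exact h hX'
  rw [mem_gauge_iff]
  simp [key]

/-- **The `2 × 2` Bacon–Shor code is a subsystem code with one logical qubit and distance `2`** (`n = 4`,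
`dim Ḡ = 4`, `dim S̄ = 2`: one gauge qubit). Column: proved theorem.
[cite: BravyiTerhal2009, §1.3 (p. 7: «This code has distance L … The code has one logical qubit»), L = 2; Bravyi2011Subsystem, §3] -/
theorem isSubsystemCode : IsSubsystemCode gauge 1 2 := by
  refine ⟨?_, hasSubsystemMinDist_two⟩
  rw [finrank_sympDual_gauge, finrank_gaugeStabilizer]

/-- `X̄ = X₀X₁` is a dressed (indeed bare) logical operator of weight `2`: the distance `2` is attained.
[cite: BravyiTerhal2009, §1.3 (p. 7: «X̄ = ∏_j X_{1,j}»)] -/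
theorem logicalX_dressed : logicalX ∈ sympDual (gaugeStabilizer gauge) ∧ logicalX ∉ gauge ∧
    sympWeight logicalX = 2 := by
  refine ⟨?_, ?_, ?_⟩
  · refine sympDual_le_sympDual_gaugeStabilizer gauge ?_
    rw [mem_sympDual_gauge_iff]
    simp [logicalX, xOp]
    decide
  · rw [mem_gauge_iff]
    simp [logicalX, xOp]
  · unfold sympWeight
    simp [logicalX, xOp]
    decide

/-- The distance is exactly `2`. [cite: BravyiTerhal2009, §1.3 (p. 7: «This code has distance L»), L = 2] -/
theorem not_hasSubsystemMinDist_three : ¬ HasSubsystemMinDist gauge 3 := by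
  intro h
  have := h logicalX logicalX_dressed.1 logicalX_dressed.2.1
  rw [logicalX_dressed.2.2] at this
  omega

/-- The gauge space is NOT self-orthogonal (`X₀X₂` and `Z₀Z₁` anticommute): this is a subsystem code that is not a
stabilizer code. [cite: BravyiTerhal2009, §1.3 (p. 7: «some subsystem codes with local generators originate from subspace codes with highly non-local stabilizer groups»)] -/
theorem not_isSelfOrthogonal : ¬ IsSelfOrthogonal gauge := by
  intro h
  have h02 : sympInner (gen 0) (gen 2) = 0 :=
    (mem_sympDual_iff.1 (h (Submodule.subset_span ⟨2, rfl⟩))) _ (Submodule.subset_span ⟨0, rfl⟩)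
  have := (sympInner_gen (gen 2)).1
  rw [h02] at this
  simp [gen, zOp] at this

end BaconShor

end Literature.InformationTheory.QuantumCodes
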